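import Summits.Ventures.HodgeRepro2.T5IsotypicPartsDense

/-!
# T5AdmissibilityToy — the hypotheses of row 88's (A3)(a) theorem instantiate jointly (non-vacuity)

Cell pub-hodge-repro2, seat p5, Tier 5.  Row 88's
`T5IsotypicPartsDense.finite_isotypicComponent_restrictProd_of_decompositions` carries twenty-odd
hypotheses; this file exhibits one model in which ALL of them hold simultaneously, so that the
statement is not vacuous: `E = ℂ`, `A = B = K₁ = K₂ = Unit` (trivial groups; `Unit` is compact,
totally disconnected, Hausdorff), `ρ = 1`, one isotypic index `P = Unit` with `σ = 1` on `F = ℂ`,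
`W₀ = ⊤`, the decomposition `S = {⊤}` of every `L^{K'} = ⊤`, the `K`-type `ρτ = 1` on `ℂ` with
`S₁ = ⊤`.  The conclusion — the `ρτ`-isotypic part of `W₀ = ℂ` is finite-dimensional — is of course
true here for trivial reasons; the point is `toy_hypotheses`: every hypothesis is met, and
`toy_conclusion` derives the conclusion THROUGH row 88's theorem.

* `eq_bot_or_eq_top_submodule`: a subspace of `ℂ` is `⊥` or `⊤` (`ℂ` is a simple `ℂ`-module);
* `isometryTop`: `ℂ ≃ₗᵢ[ℂ] (⊤ : Submodule ℂ ℂ)`; `irreducibleOn_top`; `top_mem_copies`;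
* `isSimpleModule_trivial_asModule`: `ℂ` with the trivial action of a group is a simple module over
  its group algebra (every `ℂ[G]`-submodule is a `ℂ`-subspace);
* **`toy_hypotheses`** / **`toy_conclusion`**.

Imports row 88.  Axioms: propext, Classical.choice, Quot.sound.
README §8(d): uses an L-value-free non-vanishing device: NO.
-/

namespace Summit.Ventures.HodgeRepro2.T5AdmissibilityToy

open scoped InnerProductSpace
open Summit.Ventures.HodgeRepro2.T5CompactDiscreteDecomposition (IrreducibleOn)
open Summit.Ventures.HodgeRepro2.T5FiniteMultiplicity (IsUnitaryEquiv)
open Summit.Ventures.HodgeRepro2.T5IsotypicStep4Adelic (copies isotypicPart)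
open Summit.Ventures.HodgeRepro2.T5AdmissibilityHilbert (invariants mem_invariants restrictProd)
open Summit.Ventures.HodgeRepro2.T5IsotypicRestrict (compRep)
open Summit.Ventures.HodgeRepro2.T5FiniteCopiesModule (toRep)

/-- A subspace of `ℂ` is `⊥` or `⊤`. -/
theorem eq_bot_or_eq_top_submodule (V : Submodule ℂ ℂ) : V = ⊥ ∨ V = ⊤ :=
  IsSimpleOrder.eq_bot_or_eq_top V

/-- `⊤ ≠ ⊥` in `Submodule ℂ ℂ`. -/
theorem top_ne_bot_submodule : (⊤ : Submodule ℂ ℂ) ≠ ⊥ := by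
  intro h
  have h1 : (1 : ℂ) ∈ (⊤ : Submodule ℂ ℂ) := Submodule.mem_top
  rw [h, Submodule.mem_bot] at h1
  exact one_ne_zero h1

/-- `ℂ ≃ₗᵢ[ℂ] ⊤`. -/
noncomputable def isometryTop : ℂ ≃ₗᵢ[ℂ] (⊤ : Submodule ℂ ℂ) :=
  LinearEquiv.isometryOfInner (Submodule.topEquiv (R := ℂ) (M := ℂ)).symm (fun x y => by
    rw [Submodule.coe_inner]
    rfl)

/-- `⊤` is irreducible for the trivial representation of any group on `ℂ`. -/
theorem irreducibleOn_top {G : Type*} [Group G] :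
    IrreducibleOn (1 : G →* (ℂ →L[ℂ] ℂ)) (⊤ : Submodule ℂ ℂ) :=
  ⟨by rw [Submodule.top_coe]; exact isClosed_univ, fun _ _ _ => Submodule.mem_top,
    top_ne_bot_submodule, fun V _ _ _ => eq_bot_or_eq_top_submodule V⟩

/-- `⊤` is a copy of the trivial representation `1` of `G` on `ℂ`. -/
theorem top_mem_copies {G : Type*} [Group G] :
    (⊤ : Submodule ℂ ℂ) ∈ copies (1 : G →* (ℂ →L[ℂ] ℂ)) (1 : G →* (ℂ →L[ℂ] ℂ)) :=
  ⟨by rw [Submodule.top_coe]; exact isClosed_univ, fun _ _ _ => Submodule.mem_top,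
    isometryTop, fun _ _ => rfl⟩

/-- `ℂ` with the trivial action of a group `G` is a simple module over `ℂ[G]`: every `ℂ[G]`-submodule
is a `ℂ`-subspace, hence `⊥` or `⊤`. -/
theorem isSimpleModule_trivial_asModule {G : Type*} [Group G] :
    IsSimpleModule (MonoidAlgebra ℂ G) (1 : Representation ℂ G ℂ).asModule := by
  haveI : Nontrivial (1 : Representation ℂ G ℂ).asModule :=
    (Representation.asModuleEquiv (1 : Representation ℂ G ℂ)).toEquiv.nontrivial
  refine { eq_bot_or_eq_top := fun N => ?_ }
  by_cases hN : N = ⊥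
  · exact Or.inl hN
  · right
    obtain ⟨x, hxN, hx0⟩ := (Submodule.ne_bot_iff N).mp hN
    rw [Submodule.eq_top_iff']
    intro y
    -- `y = (y / x) • x` with the scalar `single 1 (y / x)`
    set e := Representation.asModuleEquiv (1 : Representation ℂ G ℂ) with he
    have hx : (e x : ℂ) ≠ 0 := by
      intro h
      apply hx0
      exact e.map_eq_zero_iff.mp h
    have key : y = MonoidAlgebra.single (1 : G) ((e y : ℂ) / (e x : ℂ)) • x := by
      apply e.injective
      rw [he, Representation.single_smul, MonoidHom.one_apply, Module.End.one_apply, smul_eq_mul,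
        div_mul_cancel₀ _ hx]
      rfl
    rw [key]
    exact N.smul_mem _ hxN

section Data

/-- The trivial representation of `Unit × Unit` on `ℂ`. -/
noncomputable abbrev ρ₀ : Unit × Unit →* (ℂ →L[ℂ] ℂ) := 1

/-- The trivial irreducible unitary representation of `Unit` on `ℂ`, the one index `π : Unit`. -/
noncomputable abbrev σ₀ : Unit → (Unit →* (ℂ →L[ℂ] ℂ)) := fun _ => 1

/-- The `K`-type: the trivial representation of `Unit × Unit` on `ℂ`. -/
abbrev ρτ₀ : Representation ℂ (Unit × Unit) ℂ := 1

/-- `ρτ₀` is irreducible. -/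
theorem ρτ₀_isIrreducible : ρτ₀.IsIrreducible :=
  (Representation.irreducible_iff_isSimpleModule_asModule ρτ₀).mpr isSimpleModule_trivial_asModule

/-- `S₁ = ⊤ ≤ ρτ₀|_{K₁}` is simple. -/
theorem isSimpleModule_top_compRep :
    IsSimpleModule (MonoidAlgebra ℂ Unit)
      (⊤ : Submodule (MonoidAlgebra ℂ Unit) (compRep (MonoidHom.inl Unit Unit) ρτ₀).asModule) := by
  haveI : IsSimpleModule (MonoidAlgebra ℂ Unit) (compRep (MonoidHom.inl Unit Unit) ρτ₀).asModule := by
    have h := isSimpleModule_trivial_asModule (G := Unit)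
    exact h
  exact IsSimpleModule.congr (Submodule.topEquiv (R := MonoidAlgebra ℂ Unit)
    (M := (compRep (MonoidHom.inl Unit Unit) ρτ₀).asModule))

/-- The invariants of the trivial representation are everything. -/
theorem invariants_eq_top (K' : Set Unit) : invariants ρ₀ (1 : Unit →* Unit) K' = ⊤ := by
  ext x
  simp only [mem_invariants, Submodule.mem_top, iff_true]
  intro k _
  rfl

/-- Every `ℂ`-subspace of `ℂ` (as a `ℂ[Unit]`-submodule of the trivial module) is
finite-dimensional. -/
theorem finite_isotypicComponent_toy
    (p : Submodule (MonoidAlgebra ℂ Unit) (toRep ((σ₀ ()).comp (1 : Unit →* Unit))).asModule) :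
    Module.Finite ℂ p :=
  Module.Finite.of_injective (p.subtype.restrictScalars ℂ) Subtype.val_injective

end Data

/-- **Every hypothesis of row 88's `finite_isotypicComponent_restrictProd_of_decompositions` holds
in the toy** (`E = ℂ`, all groups `Unit`, everything trivial), and the theorem applies: the
`ρτ₀`-isotypic part of `W₀ = ⊤` is finite-dimensional. -/
theorem toy_conclusion :
    Module.Finite ℂ (isotypicComponent (MonoidAlgebra ℂ (Unit × Unit))
      (restrictProd (1 : Unit × Unit →* ((⊤ : Submodule ℂ ℂ) →L[ℂ] (⊤ : Submodule ℂ ℂ)))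
        (1 : Unit →* Unit) (1 : Unit →* Unit)).asModule ρτ₀.asModule) := by
  haveI := ρτ₀_isIrreducible
  haveI := isSimpleModule_top_compRep
  haveI := finite_isotypicComponent_toy
    (isotypicComponent (MonoidAlgebra ℂ Unit) (toRep ((σ₀ ()).comp (1 : Unit →* Unit))).asModule
      (⊤ : Submodule (MonoidAlgebra ℂ Unit) (compRep (MonoidHom.inl Unit Unit) ρτ₀).asModule))
  refine T5IsotypicPartsDense.finite_isotypicComponent_restrictProd_of_decompositions
    (ρ := ρ₀) (fun g => by simp) σ₀ (fun _ _ => by simp)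
    (fun _ V _ _ => eq_bot_or_eq_top_submodule V)
    (fun π π' h => absurd (Subsingleton.elim π π') h)
    (fun W hW => ?_) (1 : Unit →* Unit) (1 : Unit →* Unit) (fun v => continuous_const)
    (fun K' => ?_) () (W₀ := ⊤) 1 (fun _ _ => rfl) ?_ ρτ₀
    (⊤ : Submodule (MonoidAlgebra ℂ Unit) (compRep (MonoidHom.inl Unit Unit) ρτ₀).asModule)
    (fun _ _ => rfl) (fun v => continuous_const)
  · -- hrep: an irreducible closed stable subspace of ℂ is ⊤, a copy of σ₀ ()
    rcases eq_bot_or_eq_top_submodule W with h | h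
    · exact absurd h hW.2.2.1
    · subst h
      exact ⟨(), isometryTop, fun _ _ => rfl⟩
  · -- hdec: S = {⊤}
    refine ⟨{⊤}, ?_, Set.pairwise_singleton _ _, ?_, ?_⟩
    · intro W hW
      rw [Set.mem_singleton_iff] at hW
      subst hW
      exact irreducibleOn_top
    · rw [sSup_singleton, invariants_eq_top]
      exact le_antisymm le_top (Submodule.le_topologicalClosure _)
    · intro W₀ _
      exact (Set.finite_singleton ⊤).subset fun W hW => hW.1
  · -- hπ: ⊤ ≤ isotypicPart (ρ₀ ∘ inl) (σ₀ ())
    exact le_trans (le_sSup top_mem_copies) (Submodule.le_topologicalClosure _)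

end Summit.Ventures.HodgeRepro2.T5AdmissibilityToy
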